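import Summits.QuantumFields.YangMills.Theorems.BalabanLadderInfVolRPLatticeOSForm
import Summits.QuantumFields.YangMills.Theorems.LangevinControlUVOSLegsAtWeakCouplingCStubRopeRPPos
import HarnessLib

/-!
# Infinite-volume reflection positivity, IV: E2 of continuum limits of infinite-volume lattice states

R136 (i) «infinite-volume ∕ continuum-from-UV» programme (director-ym), prover seat `ym-infvol-p3`, pre-birth
support filed `--supports` the spine leg `UV` (stmt-QuantumFields-19351) of `route-QuantumFields-BalabanLadder`.
HONEST FRAMING: conditional material for the EXISTENCE half (OS0–OS3 of a continuum limit); not a mass gap, not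
Clay; NOTHING is asserted about Yang–Mills. «RP passes to the limit»: the tree proves that reflection positivity
passes from the torus Wilson states to their infinite-volume weak limits (GaugeBoot
`siteRP_zero_of_mem_infiniteVolumeLimitPoints`); files I–III turn that into EXACT lattice E2 of the centred
plane-string distributions `stateDist` of such a state (`stateDist_osForm_nonneg_smul`); this file passes it through
the continuum limit `a_k → 0`.

* `rpPos_of_eventually_nonneg` — ABSTRACT INHERITANCE: if approximating functionals `Λ k n` converge on `⁰𝒮`
  (off-diagonal test functions) to a one-field Schwinger family `S₁`, and for every `T` and every positive-time
  off-diagonal tuple with time supports in `(0, T]` the approximating OS forms `Σᵢⱼ Λ k (ΘFᵢ* ⊗ Fⱼ)` are eventually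
  `≥ 0` (real), then `RPPos S₁` (spine `DlrCollarTransfer.RPPos`: E2 on all positive-time off-diagonal tuples) — the
  witnesses lie in `⁰𝒮` (`isOffDiagonal_osAdjoint_appendTensor`), and general tuples follow by the compact off-diagonal
  cutoffs of the spine (`exists_offDiagonal_cutoff_tendsto'`, `cutoff_props_pos`) and continuity of `S₁ n`;
* **`rpPos_of_stateDist_tendsto`** — E2 OF THE CONTINUUM LIMIT OF INFINITE-VOLUME STATES: for site-RP finite measures
  `μ k` on `LGConfig 4 G`, spacings `a k > 0`, `a k → 0`, boxes with `a k · B k → ∞`, centre-type offsets, any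
  centrings `m k` and real renormalisations `c k`, if `(c k)^n · stateDist (μ k) (a k) (B k) o (m k) n F → S₁ n F`
  for off-diagonal `F`, then `RPPos S₁`, hence `S₁.toLabelled.IsReflectionPositive`
  (`isReflectionPositive_of_stateDist_tendsto`);
* `rpPos_of_torusLimitStates` / `isReflectionPositive_of_torusLimitStates` — the same read off torus limit points
  `μ k ∈ infiniteVolumeLimitPoints r.ρ (β k)`, `β k ≥ 0` (the weak limits p2 produces), with the plaquette-centre
  offsets `centreOffset`: NO moment bound, NO shift-defect export is needed for E2.

References: K. Osterwalder, R. Schrader, CMP 31 (1973) §2, CMP 42 (1975) §4; K. Osterwalder, E. Seiler, Ann. Phys.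
110 (1978) §2; J. Glimm, A. Jaffe, Quantum Physics (1987) §6.1.
-/

noncomputable section

open scoped SchwartzMap BigOperators ComplexConjugate
open MeasureTheory Filter Topology
open Literature.MathematicalPhysics.QuantumFieldTheory Literature.MathematicalPhysics.QuantumLattice
open Literature.MathematicalPhysics.AQFT
open Literature.Probability.LatticeModels (box Site)
open Summit.QuantumFields.GaugeBoot (configSiteReflect siteHalfEdges IsReflectionPositiveFor
  siteRP_zero_of_mem_infiniteVolumeLimitPoints)
open Summit.QuantumFields.YangMills.Cruxes.OSLegsFromFemtoAndGap.DlrCollarTransfer (RPPos isReflectionPositive_of_rpPos)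
open Summit.QuantumFields.YangMills.Theorems.OSLegsFromFemtoAndGap (cutoff_props_pos exists_offDiagonal_cutoff_tendsto')
open Summit.QuantumFields.YangMills.Theorems.NPointIsotropy.QuarterTurnCornerOperator.UnorderedRP
  (isOffDiagonal_osAdjoint_appendTensor)

namespace Summit.QuantumFields.YangMills.Theorems.InfVolRP

/-! ### Abstract inheritance of `RPPos` -/

/-- **`RPPos` of a limit from eventual positivity of the approximating OS forms.** Let `Λ k n` be any functionals
on `n`-point test functions converging to `S₁ n F` for every off-diagonal `F`, such that for every `T` and every
positive-time off-diagonal tuple `Fⱼ` with time supports in `(0, T]` the OS forms `Σᵢⱼ Λ k (ΘFᵢ* ⊗ Fⱼ)` are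
eventually real and non-negative. Then `S₁` is reflection positive on all positive-time off-diagonal tuples. -/
theorem rpPos_of_eventually_nonneg (S₁ : SchwingerFamily (EuclideanSpace ℝ (Fin 4)))
    (Λ : ℕ → (n : ℕ) → 𝓢((Fin n → (EuclideanSpace ℝ (Fin 4))), ℂ) → ℂ)
    (hlim : ∀ (n : ℕ) (F : 𝓢((Fin n → (EuclideanSpace ℝ (Fin 4))), ℂ)), IsOffDiagonal F →
      Tendsto (fun k => Λ k n F) atTop (𝓝 (S₁ n F)))
    (hpos : ∀ (T : ℝ) (N : ℕ) (deg : Fin N → ℕ)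
      (F : (j : Fin N) → 𝓢((Fin (deg j) → (EuclideanSpace ℝ (Fin 4))), ℂ)),
      (∀ j, IsPositiveTimeMulti (F j)) → (∀ j, IsOffDiagonal (F j)) →
      (∀ j (u : Fin (deg j) → (EuclideanSpace ℝ (Fin 4))), (∃ l, u l 0 ≤ 0 ∨ T < u l 0) → F j u = 0) →
        ∀ᶠ k in atTop,
          0 ≤ (∑ i, ∑ j, Λ k (deg i + deg j) ((osAdjoint (F i)).appendTensor (F j))).re ∧
            (∑ i, ∑ j, Λ k (deg i + deg j) ((osAdjoint (F i)).appendTensor (F j))).im = 0) :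
    RPPos S₁ := by
  classical
  intro N deg F hF hFo H hH
  -- Step 1: positive-time off-diagonal tuples with compact time support
  have hstep0 : ∀ (T : ℝ) (u : (j : Fin N) → 𝓢((Fin (deg j) → (EuclideanSpace ℝ (Fin 4))), ℂ)),
      (∀ j, IsPositiveTimeMulti (u j)) → (∀ j, IsOffDiagonal (u j)) →
      (∀ j (x : Fin (deg j) → (EuclideanSpace ℝ (Fin 4))), (∃ l, x l 0 ≤ 0 ∨ T < x l 0) → u j x = 0) →
      0 ≤ (∑ i, ∑ j, S₁ (deg i + deg j) ((osAdjoint (u i)).appendTensor (u j))).re ∧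
        (∑ i, ∑ j, S₁ (deg i + deg j) ((osAdjoint (u i)).appendTensor (u j))).im = 0 := by
    intro T u hu huo huT
    have hconv : Tendsto (fun k => ∑ i, ∑ j, Λ k (deg i + deg j) ((osAdjoint (u i)).appendTensor (u j))) atTop
        (𝓝 (∑ i, ∑ j, S₁ (deg i + deg j) ((osAdjoint (u i)).appendTensor (u j)))) :=
      tendsto_finsetSum _ fun i _ => tendsto_finsetSum _ fun j _ =>
        hlim _ _ (isOffDiagonal_osAdjoint_appendTensor (hu i) (huo i) (hu j) (huo j))
    have hev := hpos T N deg u hu huo huT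
    exact ⟨ge_of_tendsto ((Complex.continuous_re.tendsto _).comp hconv) (hev.mono fun k hk => hk.1),
      tendsto_nhds_unique ((Complex.continuous_im.tendsto _).comp hconv)
        (tendsto_const_nhds.congr' (hev.mono fun k hk => hk.2.symm))⟩
  -- Step 2: density of compact off-diagonal cutoffs
  choose u hu_supp hu_off hu_lim using fun j => exists_offDiagonal_cutoff_tendsto' (F j) (hFo j)
  have hstep : ∀ m : ℕ,
      0 ≤ (∑ i, ∑ j, S₁ (deg i + deg j) ((osAdjoint (u i m)).appendTensor (u j m))).re ∧
        (∑ i, ∑ j, S₁ (deg i + deg j) ((osAdjoint (u i m)).appendTensor (u j m))).im = 0 := by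
    intro m
    have hprops := fun j => cutoff_props_pos (hF j) (hu_supp j m)
    exact hstep0 (2 * ((m : ℝ) + 1)) (fun j => u j m) (fun j => (hprops j).1) (fun j => hu_off j m)
      (fun j x hx => (hprops j).2 x hx)
  have hHeq : ∀ i j, H i j = (osAdjoint (F i)).appendTensor (F j) := fun i j => by
    ext x; rw [hH i j x, SchwartzMap.appendTensor_apply]
  have hconv : Tendsto (fun m => ∑ i, ∑ j, S₁ (deg i + deg j) ((osAdjoint (u i m)).appendTensor (u j m))) atTop
      (𝓝 (∑ i, ∑ j, S₁ (deg i + deg j) (H i j))) := by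
    refine tendsto_finsetSum _ fun i _ => tendsto_finsetSum _ fun j _ => ?_
    rw [hHeq i j]
    exact ((S₁ (deg i + deg j)).continuous.tendsto _).comp
      (SchwartzMap.tendsto_appendTensor ((continuous_osAdjoint.tendsto _).comp (hu_lim i)) (hu_lim j))
  have hre := (Complex.continuous_re.tendsto _).comp hconv
  have him := (Complex.continuous_im.tendsto _).comp hconv
  exact ⟨ge_of_tendsto' hre fun m => (hstep m).1,
    tendsto_nhds_unique him (tendsto_const_nhds.congr fun m => ((hstep m).2).symm)⟩

/-! ### E2 of continuum limits of infinite-volume lattice states -/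

variable {G : Type} [Group G] [TopologicalSpace G] [IsTopologicalGroup G] [CompactSpace G]
  [MeasurableSpace G] [BorelSpace G]

/-- **E2 of the continuum limit of infinite-volume lattice states.** Let `μ k` be finite measures on the gauge
configurations of `ℤ⁴`, each reflection positive for the site mirror (`IsReflectionPositiveFor (configSiteReflect 0)
(siteHalfEdges 0) (μ k)`), `a k > 0` spacings with `a k → 0`, `B k` summation boxes with `a k · B k → ∞`, `o`
centre-type offsets, `m k` any centrings and `c k` any real renormalisations. If the renormalised centred
plane-string distributions converge on `⁰𝒮`, `(c k)^n · stateDist (μ k) (a k) (B k) o (m k) n F → S₁ n F` for every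
off-diagonal `F`, then `S₁` is reflection positive on all positive-time off-diagonal tuples (`RPPos`). -/
theorem rpPos_of_stateDist_tendsto [SecondCountableTopology G] (r : LatticeRep G)
    (μ : ℕ → Measure (LGConfig 4 G)) [∀ k, IsFiniteMeasure (μ k)]
    (hRP : ∀ᶠ k in atTop, IsReflectionPositiveFor (configSiteReflect (G := G) 0) (siteHalfEdges 0) (μ k))
    {a : ℕ → ℝ} (ha : ∀ k, 0 < a k) (ha0 : Tendsto a atTop (𝓝 0)) {B : ℕ → ℕ}
    (haB : Tendsto (fun k => a k * B k) atTop atTop) {o : Fin 4 × Fin 4 → (EuclideanSpace ℝ (Fin 4))}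
    (ho : ∀ q, 0 ≤ o q 0 ∧ o q 0 < 1)
    (hoc : ∀ q : Fin 4 × Fin 4, q.1 < q.2 → 2 * o q 0 = if q.1 = 0 then 1 else 0)
    (m : ℕ → Fin 4 × Fin 4 → ℝ) (c : ℕ → ℝ) (S₁ : SchwingerFamily (EuclideanSpace ℝ (Fin 4)))
    (hlim : ∀ (n : ℕ) (F : 𝓢((Fin n → (EuclideanSpace ℝ (Fin 4))), ℂ)), IsOffDiagonal F →
      Tendsto (fun k => (c k : ℂ) ^ n * stateDist r (μ k) (a k) (B k) o (m k) n F) atTop (𝓝 (S₁ n F))) :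
    RPPos S₁ := by
  refine rpPos_of_eventually_nonneg S₁ (fun k n F => (c k : ℂ) ^ n * stateDist r (μ k) (a k) (B k) o (m k) n F)
    hlim fun T N deg F _ _ hFT => ?_
  -- eventually `T + a k ≤ a k · B k`
  have h1 : ∀ᶠ k in atTop, a k ≤ 1 := (tendsto_order.1 ha0).2 1 one_pos |>.mono fun k hk => hk.le
  have h2 : ∀ᶠ k in atTop, T + 1 ≤ a k * B k := haB.eventually_ge_atTop (T + 1)
  filter_upwards [h1, h2, hRP] with k hk1 hk2 hRPk
  have hTB : T + a k ≤ a k * B k := by linarith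
  exact stateDist_osForm_nonneg_smul r hRPk (ha k) hTB ho hoc (m k) (c k) F hFT
    (fun i j => (osAdjoint (F i)).appendTensor (F j)) (fun i j => isAppendTensorOf_appendTensor _ _)

/-- **E2 (`IsReflectionPositive`) of the continuum limit of infinite-volume lattice states** (`RPPos ⇒ E2`, spine
`isReflectionPositive_of_rpPos`). -/
theorem isReflectionPositive_of_stateDist_tendsto [SecondCountableTopology G] (r : LatticeRep G)
    (μ : ℕ → Measure (LGConfig 4 G)) [∀ k, IsFiniteMeasure (μ k)]
    (hRP : ∀ᶠ k in atTop, IsReflectionPositiveFor (configSiteReflect (G := G) 0) (siteHalfEdges 0) (μ k))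
    {a : ℕ → ℝ} (ha : ∀ k, 0 < a k) (ha0 : Tendsto a atTop (𝓝 0)) {B : ℕ → ℕ}
    (haB : Tendsto (fun k => a k * B k) atTop atTop) {o : Fin 4 × Fin 4 → (EuclideanSpace ℝ (Fin 4))}
    (ho : ∀ q, 0 ≤ o q 0 ∧ o q 0 < 1)
    (hoc : ∀ q : Fin 4 × Fin 4, q.1 < q.2 → 2 * o q 0 = if q.1 = 0 then 1 else 0)
    (m : ℕ → Fin 4 × Fin 4 → ℝ) (c : ℕ → ℝ) (S₁ : SchwingerFamily (EuclideanSpace ℝ (Fin 4)))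
    (hlim : ∀ (n : ℕ) (F : 𝓢((Fin n → (EuclideanSpace ℝ (Fin 4))), ℂ)), IsOffDiagonal F →
      Tendsto (fun k => (c k : ℂ) ^ n * stateDist r (μ k) (a k) (B k) o (m k) n F) atTop (𝓝 (S₁ n F))) :
    S₁.toLabelled.IsReflectionPositive :=
  isReflectionPositive_of_rpPos (rpPos_of_stateDist_tendsto r μ hRP ha ha0 haB ho hoc m c S₁ hlim)

/-! ### Read off torus limit points (the weak limits of the thermodynamic-limit step) -/

/-- **E2 of the continuum limit along torus limit states, plaquette-centre smearing.** For every sequence of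
infinite-volume limit points `μ k ∈ infiniteVolumeLimitPoints r.ρ (β k)` of the torus Wilson states, `β k ≥ 0`
eventually (the tree's thermodynamic-limit states), spacings `a k > 0`, `a k → 0`, boxes with `a k · B k → ∞`, any centrings
and real renormalisations: if the renormalised centre-smeared plane-string distributions converge on `⁰𝒮` to
`S₁`, then `RPPos S₁`. Lattice RP is the GaugeBoot theorem `siteRP_zero_of_mem_infiniteVolumeLimitPoints`. -/
theorem rpPos_of_torusLimitStates [T2Space G] [SecondCountableTopology G] (r : LatticeRep G) {β : ℕ → ℝ}
    (hβ : ∀ᶠ k in atTop, 0 ≤ β k) (μ : ℕ → Measure (LGConfig 4 G))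
    (hμ : ∀ k, μ k ∈ infiniteVolumeLimitPoints (d := 4) r.ρ (β k))
    {a : ℕ → ℝ} (ha : ∀ k, 0 < a k) (ha0 : Tendsto a atTop (𝓝 0)) {B : ℕ → ℕ}
    (haB : Tendsto (fun k => a k * B k) atTop atTop) (m : ℕ → Fin 4 × Fin 4 → ℝ) (c : ℕ → ℝ)
    (S₁ : SchwingerFamily (EuclideanSpace ℝ (Fin 4)))
    (hlim : ∀ (n : ℕ) (F : 𝓢((Fin n → (EuclideanSpace ℝ (Fin 4))), ℂ)), IsOffDiagonal F →
      Tendsto (fun k => (c k : ℂ) ^ n * stateDist r (μ k) (a k) (B k) centreOffset (m k) n F) atTop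
        (𝓝 (S₁ n F))) :
    RPPos S₁ := by
  haveI : ∀ k, IsFiniteMeasure (μ k) := fun k => by
    obtain ⟨L, -, hprob, -⟩ := hμ k
    infer_instance
  exact rpPos_of_stateDist_tendsto r μ
    (hβ.mono fun k hk => siteRP_zero_of_mem_infiniteVolumeLimitPoints r.ρ r.continuous hk (hμ k)) ha ha0 haB
    centreOffset_time (fun _ hq => two_mul_centreOffset_zero hq) m c S₁ hlim

/-- **E2 (`IsReflectionPositive`) of the continuum limit along torus limit states, plaquette-centre smearing.** -/
theorem isReflectionPositive_of_torusLimitStates [T2Space G] [SecondCountableTopology G] (r : LatticeRep G)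
    {β : ℕ → ℝ} (hβ : ∀ᶠ k in atTop, 0 ≤ β k) (μ : ℕ → Measure (LGConfig 4 G))
    (hμ : ∀ k, μ k ∈ infiniteVolumeLimitPoints (d := 4) r.ρ (β k))
    {a : ℕ → ℝ} (ha : ∀ k, 0 < a k) (ha0 : Tendsto a atTop (𝓝 0)) {B : ℕ → ℕ}
    (haB : Tendsto (fun k => a k * B k) atTop atTop) (m : ℕ → Fin 4 × Fin 4 → ℝ) (c : ℕ → ℝ)
    (S₁ : SchwingerFamily (EuclideanSpace ℝ (Fin 4)))
    (hlim : ∀ (n : ℕ) (F : 𝓢((Fin n → (EuclideanSpace ℝ (Fin 4))), ℂ)), IsOffDiagonal F →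
      Tendsto (fun k => (c k : ℂ) ^ n * stateDist r (μ k) (a k) (B k) centreOffset (m k) n F) atTop
        (𝓝 (S₁ n F))) :
    S₁.toLabelled.IsReflectionPositive :=
  isReflectionPositive_of_rpPos (rpPos_of_torusLimitStates r hβ μ hμ ha ha0 haB m c S₁ hlim)

end Summit.QuantumFields.YangMills.Theorems.InfVolRP

end
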